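import Summits.NavierStokesRegularity.NavierStokesRegularity.Theorems.SoloSalvageWu2026ConstructTools
import Summits.NavierStokesRegularity.NavierStokesRegularity.Theorems.SoloSalvageWu2026ConstructProfile
import Mathlib.MeasureTheory.Integral.Lebesgue.DominatedConvergence
import HarnessLib

/-!
# C177 `Wu2026` — tools for sub-binder (C) of `Step_construct`: limit passages on the support of a
# test function and the vanishing viscous terms `ν_j ∫ φ|∇V_j|²` (cell `pub/ns-inputs`, seat
# `ns-in-wu-con`; route business of `GaldiLiouvilleGate`, item stmt-NavierStokesRegularity-0897)

Tools for the passage `j → ∞` in the tested identities of the rescaled system (3.50) (p.17 l.53 –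
p.19 l.76): on a compact `K ⊆ ℝ³ ∖ {0}` carrying the test function,

* `tendsto_lintegral_three_terms` — `∫_K (A e_j + B (d_j² + |V| d_j)) → 0` from
  `∫_K d_j⁴ → 0`, `∫_K e_j² → 0`, `|V|⁴ ∈ L¹(K)` (Hölder on a set of finite measure), the common
  shape of the quadratic (`V_j ⊗ V_j`, `|V_j|²`) and linear (`P_j`) error terms;
* `tendsto_lintegral_one_of_four` — `∫_K d_j → 0`;
* `abs_inner_clm_sub_le` — `|⟪a, La⟫ − ⟪b, Lb⟫| ≤ 2‖L‖(|a−b|² + |b||a−b|)`;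
* `tendsto_visc_dirichlet_blowDown` — **(3.55)–(3.56)** (p.18 l.40 – p.19 l.62): the rescaled
  viscous dissipation on the support of a test function vanishes,
  `ν_j ∫ φ |∇V_j|² → 0`, since `ν_j ∫_K |∇V_j|² dy = ν ∫_{R_jK} |∇v|² dx` EXACTLY (scaling) and
  `R_j K` escapes every ball while `D(v) < ∞` (dominated convergence on the tails
  `∫_{|x| > R_jδ/2} |∇v|²`).

Theorems only, standard axioms, no `sorry`.

WHAT THIS IS NOT: not a proof of `Step_construct`; not a claim about NS regularity or blow-up; not
a claim about any author beyond the typed locator.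
-/

set_option linter.dupNamespace false

noncomputable section

open MeasureTheory Set Filter Topology InnerProductSpace Metric
open scoped ENNReal NNReal Topology RealInnerProductSpace

namespace Summit.NavierStokesRegularity.NavierStokesRegularity.Theorems.Wu2026Salvage

open Literature.Analysis.FluidPDE Literature.Analysis.FunctionSpaces Literature.Claims.NS.Wu2026

/-! ## Three-term Hölder limit on a set of finite measure -/

/-- **The common error bookkeeping**: on `K` of finite measure, if `∫_K d_j⁴ → 0`, `∫_K e_j² → 0`
and `∫_K W⁴ < ∞`, then `∫_K (A e_j + B (d_j² + W d_j)) → 0` for finite constants `A, B`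
(exponent reduction `1 < 2`, `2 < 4` and Cauchy–Schwarz for `W d_j`). [folklore] -/
theorem tendsto_lintegral_three_terms {K : Set E3} (hKfin : volume K ≠ ∞)
    {d e : ℕ → E3 → ℝ≥0∞} {W : E3 → ℝ≥0∞}
    (hd : ∀ j, AEMeasurable (d j) (volume.restrict K))
    (he : ∀ j, AEMeasurable (e j) (volume.restrict K)) (hW : AEMeasurable W (volume.restrict K))
    (hW4 : ∫⁻ y in K, W y ^ (4 : ℝ) ≠ ∞)
    (hdlim : Tendsto (fun j => ∫⁻ y in K, d j y ^ (4 : ℝ)) atTop (𝓝 0))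
    (helim : Tendsto (fun j => ∫⁻ y in K, e j y ^ ((4 : ℝ) / 2)) atTop (𝓝 0))
    {A B : ℝ≥0∞} (hA : A ≠ ∞) (hB : B ≠ ∞) :
    Tendsto (fun j => ∫⁻ y in K, (A * e j y + B * (d j y ^ (2 : ℝ) + W y * d j y))) atTop
      (𝓝 0) := by
  have h1 : Tendsto (fun j => ∫⁻ y in K, e j y) atTop (𝓝 0) := by
    have hb : ∀ j, ∫⁻ y in K, e j y ≤
        (∫⁻ y in K, e j y ^ ((4 : ℝ) / 2)) ^ ((1 : ℝ) / ((4 : ℝ) / 2)) *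
          volume K ^ (1 - 1 / ((4 : ℝ) / 2)) := fun j => by
      have := setLIntegral_rpow_le_of_lt (he j) (s := 1) (r := (4 : ℝ) / 2) one_pos (by norm_num)
      simpa only [ENNReal.rpow_one] using this
    refine tendsto_zero_of_le ?_ hb
    exact tendsto_rpow_mul_const_zero helim (by norm_num)
      (ENNReal.rpow_ne_top_of_nonneg (by norm_num) hKfin)
  have h2 : Tendsto (fun j => ∫⁻ y in K, d j y ^ (2 : ℝ)) atTop (𝓝 0) := by
    have hb : ∀ j, ∫⁻ y in K, d j y ^ (2 : ℝ) ≤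
        (∫⁻ y in K, d j y ^ (4 : ℝ)) ^ ((2 : ℝ) / 4) * volume K ^ (1 - (2 : ℝ) / 4) :=
      fun j => setLIntegral_rpow_le_of_lt (hd j) (by norm_num) (by norm_num)
    refine tendsto_zero_of_le ?_ hb
    exact tendsto_rpow_mul_const_zero hdlim (by norm_num)
      (ENNReal.rpow_ne_top_of_nonneg (by norm_num) hKfin)
  have hW2 : ∫⁻ y in K, W y ^ (2 : ℝ) ≠ ∞ := by
    refine ne_top_of_le_ne_top ?_ (setLIntegral_rpow_le_of_lt hW (by norm_num : (0:ℝ) < 2)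
      (by norm_num : (2 : ℝ) < 4))
    exact ENNReal.mul_ne_top (ENNReal.rpow_ne_top_of_nonneg (by norm_num) hW4)
      (ENNReal.rpow_ne_top_of_nonneg (by norm_num) hKfin)
  have h3 : Tendsto (fun j => ∫⁻ y in K, W y * d j y) atTop (𝓝 0) := by
    have hb : ∀ j, ∫⁻ y in K, W y * d j y ≤
        (∫⁻ y in K, W y ^ ((1 : ℝ) / 2)⁻¹) ^ ((1 : ℝ) / 2) *
          (∫⁻ y in K, d j y ^ ((1 : ℝ) / 2)⁻¹) ^ ((1 : ℝ) / 2) := fun j =>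
      setLIntegral_mul_le_holder hW (hd j) (by norm_num) (by norm_num) (by norm_num)
    have einv : ((1 : ℝ) / 2)⁻¹ = 2 := by norm_num
    simp only [einv] at hb
    refine tendsto_zero_of_le ?_ hb
    have := tendsto_rpow_mul_const_zero h2 (by norm_num : (0 : ℝ) < 1 / 2)
      (ENNReal.rpow_ne_top_of_nonneg (by norm_num : (0 : ℝ) ≤ 1 / 2) hW2)
    simpa only [mul_comm] using this
  have h23 : Tendsto (fun j => B * ((∫⁻ y in K, d j y ^ (2 : ℝ)) + ∫⁻ y in K, W y * d j y)) atTop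
      (𝓝 0) := by
    have h := h2.add h3
    rw [add_zero] at h
    have := ENNReal.Tendsto.const_mul h (Or.inr hB)
    rwa [mul_zero] at this
  have h1' : Tendsto (fun j => A * ∫⁻ y in K, e j y) atTop (𝓝 0) := by
    have := ENNReal.Tendsto.const_mul h1 (Or.inr hA)
    rwa [mul_zero] at this
  have hsum := h1'.add h23
  rw [add_zero] at hsum
  refine (tendsto_congr fun j => ?_).2 hsum
  have hm1 : AEMeasurable (fun y => A * e j y) (volume.restrict K) := (he j).const_mul A
  have hm2 : AEMeasurable (fun y => d j y ^ (2 : ℝ)) (volume.restrict K) := (hd j).pow_const _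
  have hm3 : AEMeasurable (fun y => d j y ^ (2 : ℝ) + W y * d j y) (volume.restrict K) :=
    hm2.add (hW.mul (hd j))
  rw [lintegral_add_left' hm1, lintegral_const_mul'' _ (he j), lintegral_const_mul'' _ hm3,
    lintegral_add_left' hm2]

/-- `∫_K d_j → 0` from `∫_K d_j⁴ → 0` on a set of finite measure. [folklore] -/
theorem tendsto_lintegral_one_of_four {K : Set E3} (hKfin : volume K ≠ ∞) {d : ℕ → E3 → ℝ≥0∞}
    (hd : ∀ j, AEMeasurable (d j) (volume.restrict K))
    (hdlim : Tendsto (fun j => ∫⁻ y in K, d j y ^ (4 : ℝ)) atTop (𝓝 0)) :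
    Tendsto (fun j => ∫⁻ y in K, d j y) atTop (𝓝 0) := by
  have hb : ∀ j, ∫⁻ y in K, d j y ≤
      (∫⁻ y in K, d j y ^ (4 : ℝ)) ^ ((1 : ℝ) / 4) * volume K ^ (1 - (1 : ℝ) / 4) := fun j => by
    have := setLIntegral_rpow_le_of_lt (hd j) (s := 1) (r := (4 : ℝ)) one_pos (by norm_num)
    simpa only [ENNReal.rpow_one] using this
  refine tendsto_zero_of_le ?_ hb
  exact tendsto_rpow_mul_const_zero hdlim (by norm_num)
    (ENNReal.rpow_ne_top_of_nonneg (by norm_num) hKfin)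

/-! ## Pointwise error of the quadratic term -/

/-- `|⟪a, La⟫ − ⟪b, Lb⟫| ≤ 2‖L‖(|a − b|² + |b||a − b|)` for a continuous linear `L`. [folklore] -/
theorem abs_inner_clm_sub_le (L : E3 →L[ℝ] E3) (a b : E3) :
    |⟪a, L a⟫ - ⟪b, L b⟫| ≤ 2 * ‖L‖ * (‖a - b‖ ^ 2 + ‖b‖ * ‖a - b‖) := by
  have hM : 0 ≤ ‖L‖ := norm_nonneg _
  have hsplit : ⟪a, L a⟫ - ⟪b, L b⟫ = ⟪a - b, L a⟫ + ⟪b, L (a - b)⟫ := by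
    rw [inner_sub_left, map_sub, inner_sub_right]; ring
  rw [hsplit]
  have ha : ‖a‖ ≤ ‖b‖ + ‖a - b‖ := by
    calc ‖a‖ = ‖b + (a - b)‖ := by rw [add_sub_cancel]
      _ ≤ ‖b‖ + ‖a - b‖ := norm_add_le _ _
  have h1 : |⟪a - b, L a⟫| ≤ ‖a - b‖ * (‖L‖ * (‖b‖ + ‖a - b‖)) :=
    (abs_real_inner_le_norm _ _).trans (mul_le_mul_of_nonneg_left
      ((L.le_opNorm a).trans (mul_le_mul_of_nonneg_left ha hM)) (norm_nonneg _))
  have h2 : |⟪b, L (a - b)⟫| ≤ ‖b‖ * (‖L‖ * ‖a - b‖) :=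
    (abs_real_inner_le_norm _ _).trans (mul_le_mul_of_nonneg_left (L.le_opNorm _) (norm_nonneg _))
  have hd0 : 0 ≤ ‖a - b‖ := norm_nonneg _
  have hb0 : 0 ≤ ‖b‖ := norm_nonneg _
  calc |⟪a - b, L a⟫ + ⟪b, L (a - b)⟫| ≤ |⟪a - b, L a⟫| + |⟪b, L (a - b)⟫| := abs_add_le _ _
    _ ≤ ‖a - b‖ * (‖L‖ * (‖b‖ + ‖a - b‖)) + ‖b‖ * (‖L‖ * ‖a - b‖) := add_le_add h1 h2
    _ ≤ 2 * ‖L‖ * (‖a - b‖ ^ 2 + ‖b‖ * ‖a - b‖) := by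
        nlinarith [mul_nonneg hM (mul_nonneg hd0 hd0), mul_nonneg hM (mul_nonneg hb0 hd0)]

/-- Real-to-`ℝ≥0∞` bookkeeping: `|x| ≤ C(d² + βd)` gives
`‖x‖ₑ ≤ ofReal C · (ofReal d ^ 2 + ofReal β · ofReal d)`. [folklore] -/
theorem enorm_le_of_abs_le_quad {x C d β : ℝ} (hC : 0 ≤ C) (hd : 0 ≤ d) (hβ : 0 ≤ β)
    (h : |x| ≤ C * (d ^ 2 + β * d)) :
    ‖x‖ₑ ≤ ENNReal.ofReal C * (ENNReal.ofReal d ^ (2 : ℝ) + ENNReal.ofReal β * ENNReal.ofReal d) := by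
  rw [Real.enorm_eq_ofReal_abs, ENNReal.ofReal_rpow_of_nonneg hd (by norm_num : (0:ℝ) ≤ 2),
    ← ENNReal.ofReal_mul hβ, ← ENNReal.ofReal_add (by positivity) (by positivity),
    ← ENNReal.ofReal_mul hC]
  refine ENNReal.ofReal_le_ofReal ?_
  have e2 : d ^ (2 : ℝ) = d ^ (2 : ℕ) := by exact_mod_cast Real.rpow_natCast d 2
  rw [e2]
  exact h

/-- The quadratic error in `ℝ≥0∞`: `‖⟪a, La⟫ − ⟪b, Lb⟫‖ₑ ≤ ofReal (2M) (|a−b|ₑ² + |b|ₑ|a−b|ₑ)` for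
`‖L‖ ≤ M`. [folklore] -/
theorem enorm_inner_clm_sub_le {L : E3 →L[ℝ] E3} {M : ℝ} (hM : ‖L‖ ≤ M) (a b : E3) :
    ‖⟪a, L a⟫ - ⟪b, L b⟫‖ₑ ≤
      ENNReal.ofReal (2 * M) * (‖a - b‖ₑ ^ (2 : ℝ) + ‖b‖ₑ * ‖a - b‖ₑ) := by
  have hM0 : 0 ≤ M := (norm_nonneg _).trans hM
  have h := abs_inner_clm_sub_le L a b
  have h' : |⟪a, L a⟫ - ⟪b, L b⟫| ≤ 2 * M * (‖a - b‖ ^ 2 + ‖b‖ * ‖a - b‖) :=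
    h.trans (by gcongr)
  rw [← ofReal_norm (a - b), ← ofReal_norm b]
  exact enorm_le_of_abs_le_quad (by positivity) (norm_nonneg _) (norm_nonneg _) h'

/-- The `|V|²` error in `ℝ≥0∞`: `‖t|a|² − t|b|²‖ₑ ≤ ofReal (2M') (|a−b|ₑ² + |b|ₑ|a−b|ₑ)` for
`|t| ≤ M'`. [folklore] -/
theorem enorm_mul_norm_sq_sub_le {t M' : ℝ} (ht : |t| ≤ M') (a b : E3) :
    ‖t * ‖a‖ ^ 2 - t * ‖b‖ ^ 2‖ₑ ≤
      ENNReal.ofReal (2 * M') * (‖a - b‖ₑ ^ (2 : ℝ) + ‖b‖ₑ * ‖a - b‖ₑ) := by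
  have hM0 : 0 ≤ M' := (abs_nonneg _).trans ht
  have hid := abs_inner_clm_sub_le (ContinuousLinearMap.id ℝ E3) a b
  simp only [ContinuousLinearMap.id_apply, real_inner_self_eq_norm_sq] at hid
  have hid' : |‖a‖ ^ 2 - ‖b‖ ^ 2| ≤ 2 * (‖a - b‖ ^ 2 + ‖b‖ * ‖a - b‖) := by
    refine hid.trans ?_
    have h1 : ‖ContinuousLinearMap.id ℝ E3‖ ≤ 1 := ContinuousLinearMap.norm_id_le
    have h0 : 0 ≤ ‖a - b‖ ^ 2 + ‖b‖ * ‖a - b‖ := by positivity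
    nlinarith
  have h' : |t * ‖a‖ ^ 2 - t * ‖b‖ ^ 2| ≤ 2 * M' * (‖a - b‖ ^ 2 + ‖b‖ * ‖a - b‖) := by
    rw [← mul_sub, abs_mul]
    have h0 : 0 ≤ ‖a - b‖ ^ 2 + ‖b‖ * ‖a - b‖ := by positivity
    nlinarith [abs_nonneg t]
  rw [← ofReal_norm (a - b), ← ofReal_norm b]
  exact enorm_le_of_abs_le_quad (by positivity) (norm_nonneg _) (norm_nonneg _) h'

/-- The linear errors in `ℝ≥0∞`: `‖⟪a, w⟫ − ⟪b, w⟫‖ₑ ≤ ofReal M |a − b|ₑ` for `‖w‖ ≤ M`, and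
`‖r t − s t‖ₑ ≤ ofReal M' |r − s|ₑ` for `|t| ≤ M'`. [folklore] -/
theorem enorm_inner_sub_inner_le {w : E3} {M : ℝ} (hw : ‖w‖ ≤ M) (a b : E3) :
    ‖⟪a, w⟫ - ⟪b, w⟫‖ₑ ≤ ENNReal.ofReal M * ‖a - b‖ₑ := by
  rw [← inner_sub_left, Real.enorm_eq_ofReal_abs, ← ofReal_norm (a - b),
    ← ENNReal.ofReal_mul ((norm_nonneg _).trans hw)]
  refine ENNReal.ofReal_le_ofReal ?_
  calc |⟪a - b, w⟫| ≤ ‖a - b‖ * ‖w‖ := abs_real_inner_le_norm _ _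
    _ ≤ M * ‖a - b‖ := by rw [mul_comm]; gcongr

/-- See `enorm_inner_sub_inner_le`. [folklore] -/
theorem enorm_mul_sub_mul_le {t M' : ℝ} (ht : |t| ≤ M') (r s : ℝ) :
    ‖r * t - s * t‖ₑ ≤ ENNReal.ofReal M' * ‖r - s‖ₑ := by
  rw [← sub_mul, Real.enorm_eq_ofReal_abs, Real.enorm_eq_ofReal_abs,
    ← ENNReal.ofReal_mul ((abs_nonneg _).trans ht)]
  refine ENNReal.ofReal_le_ofReal ?_
  rw [abs_mul, mul_comm]
  gcongr

/-- **Limit passage on the support**: if `F_j = f` off `K`, `‖F_j − f‖ₑ ≤ G_j` pointwise and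
`∫_K G_j → 0`, then `∫ ‖F_j − f‖ₑ → 0` (so `∫ F_j → ∫ f` by `tendsto_integral_of_L1`). [folklore] -/
theorem tendsto_lintegral_sub_of_support {F : ℕ → E3 → ℝ} {f : E3 → ℝ} {K : Set E3}
    {G : ℕ → E3 → ℝ≥0∞} (hoff : ∀ j y, y ∉ K → F j y = f y)
    (hle : ∀ j y, ‖F j y - f y‖ₑ ≤ G j y)
    (hG : Tendsto (fun j => ∫⁻ y in K, G j y) atTop (𝓝 0)) :
    Tendsto (fun j => ∫⁻ y, ‖F j y - f y‖ₑ) atTop (𝓝 0) := by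
  refine tendsto_zero_of_le hG fun j => ?_
  have hsupp : Function.support (fun y => ‖F j y - f y‖ₑ) ⊆ K := fun y hy => by
    by_contra hyK
    exact hy (by simp [hoff j y hyK])
  rw [← setLIntegral_eq_of_support_subset hsupp]
  exact lintegral_mono fun y => hle j y

/-! ## The vanishing viscous term (3.55)–(3.56) -/

/-- A compact subset of `ℝ³ ∖ {0}` keeps a positive distance from the origin. [folklore] -/
theorem exists_pos_le_norm_of_subset_punctured {K : Set E3} (hK : IsCompact K)
    (hKp : K ⊆ punctured) : ∃ δ : ℝ, 0 < δ ∧ ∀ y ∈ K, δ ≤ ‖y‖ := by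
  have h0 : (0 : E3) ∈ Kᶜ := fun h => hKp h rfl
  obtain ⟨δ, hδ, hball⟩ := Metric.isOpen_iff.1 hK.isClosed.isOpen_compl 0 h0
  refine ⟨δ, hδ, fun y hy => ?_⟩
  by_contra hlt
  have hlt' : ‖y‖ < δ := not_le.1 hlt
  have : y ∈ ball (0 : E3) δ := by rwa [mem_ball, dist_zero_right]
  exact hball this hy

/-- **The tails of the Dirichlet integral vanish along escaping regions**: if `D(v) < ∞` and
`ρ_j → ∞` then `∫_{|x| > ρ_j} |∇v|² → 0` (dominated convergence; p.19 l.55–62 «since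
∫_{R³}|∇v|² < ∞ and R_j K leaves every compact set»). [cite: Wu2026, (3.56) p.19 l.55–62] -/
theorem tendsto_dirichlet_tail {v : E3 → E3} (hv : ContDiff ℝ (⊤ : ℕ∞) v) (hD : dirichlet v < ∞)
    {ρ : ℕ → ℝ} (hρ : Tendsto ρ atTop atTop) :
    Tendsto (fun j => ∫⁻ x in {x : E3 | ρ j < ‖x‖},
      ENNReal.ofReal (frobeniusNormSq (fderiv ℝ v x))) atTop (𝓝 0) := by
  set f : E3 → ℝ≥0∞ := fun x => ENNReal.ofReal (frobeniusNormSq (fderiv ℝ v x)) with hf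
  have hfm : Measurable f :=
    (ENNReal.continuous_ofReal.comp (SereginWangProof.continuous_frobeniusNormSq_fderiv hv)).measurable
  have hS : ∀ j, MeasurableSet {x : E3 | ρ j < ‖x‖} := fun j =>
    measurableSet_lt measurable_const continuous_norm.measurable
  have heq : ∀ j, ∫⁻ x in {x : E3 | ρ j < ‖x‖}, f x = ∫⁻ x, ({x : E3 | ρ j < ‖x‖}.indicator f) x :=
    fun j => (lintegral_indicator (hS j) _).symm
  simp_rw [heq]
  have h := tendsto_lintegral_of_dominated_convergence (μ := (volume : Measure E3)) f
    (F := fun j => {x : E3 | ρ j < ‖x‖}.indicator f) (f := fun _ => 0)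
    (fun j => hfm.indicator (hS j)) (fun j => Eventually.of_forall fun x => indicator_le_self _ _ x)
    hD.ne (Eventually.of_forall fun x => ?_)
  · simpa only [lintegral_zero] using h
  · have hev : ∀ᶠ j in atTop, ({x : E3 | ρ j < ‖x‖}.indicator f) x = 0 := by
      filter_upwards [hρ.eventually_ge_atTop ‖x‖] with j hj
      exact indicator_of_notMem (by simpa using hj) _
    exact tendsto_const_nhds.congr' (hev.mono fun j hj => hj.symm)

/-- **(3.55)–(3.56): the rescaled viscous dissipation vanishes on the support of a test function.**
For `v ∈ C^∞` with `D(v) < ∞`, `φ` continuous with compact support inside `ℝ³ ∖ {0}`, and scales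
`R_j → ∞` (`R_j > 0`): `ν R_j^{-1/3} ∫ φ |∇V_{R_j}|² → 0`, because
`R^{-1/3} ∫_K |∇V_R|² dy = ∫_{RK} |∇v|² dx ≤ ∫_{|x| > Rδ/2} |∇v|²` with `K ⊆ {|y| ≥ δ}`
(«ν_j ∫ |∇V_j|²φ dy = ∫_{R_jK} |∇v|² φ(x/R_j) dx → 0», p.19 l.47–62). [cite: Wu2026, (3.55)–(3.56) p.18–19] -/
theorem tendsto_visc_dirichlet_blowDown {v : E3 → E3} (hv : ContDiff ℝ (⊤ : ℕ∞) v) (hD : dirichlet v < ∞)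
    (ν : ℝ) {φ : E3 → ℝ} (hφ : Continuous φ) (hφc : HasCompactSupport φ)
    (hφp : tsupport φ ⊆ punctured) {R : ℕ → ℝ} (hRpos : ∀ j, 0 < R j)
    (hR : Tendsto R atTop atTop) :
    Tendsto (fun j => (ν * R j ^ (-(1 : ℝ) / 3)) *
      ∫ y, φ y * frobeniusNormSq (fderiv ℝ (blowDown (R j) v) y)) atTop (𝓝 0) := by
  set K : Set E3 := tsupport φ with hK_def
  have hK : IsCompact K := hφc
  obtain ⟨δ, hδ, hKδ⟩ := exists_pos_le_norm_of_subset_punctured hK hφp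
  obtain ⟨Mφ, hMφ⟩ := hφ.bounded_above_of_compact_support hφc
  have hMφ0 : 0 ≤ Mφ := (norm_nonneg _).trans (hMφ 0)
  -- the physical density and its tails
  set F : E3 → ℝ≥0∞ := fun x => ENNReal.ofReal (frobeniusNormSq (fderiv ℝ v x)) with hF
  have hFc : Continuous fun x => frobeniusNormSq (fderiv ℝ v x) :=
    SereginWangProof.continuous_frobeniusNormSq_fderiv hv
  set T : ℕ → ℝ≥0∞ := fun j => ∫⁻ x in {x : E3 | R j * (δ / 2) < ‖x‖}, F x with hT
  have hTlim : Tendsto T atTop (𝓝 0) := by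
    have hρ : Tendsto (fun j => R j * (δ / 2)) atTop atTop := hR.atTop_mul_const (by positivity)
    exact tendsto_dirichlet_tail hv hD hρ
  have hTfin : ∀ j, T j ≠ ∞ := fun j =>
    ((setLIntegral_le_lintegral _ _).trans_lt hD).ne
  have hTreal : Tendsto (fun j => (T j).toReal) atTop (𝓝 0) := by
    have := (ENNReal.tendsto_toReal ENNReal.zero_ne_top).comp hTlim
    rw [ENNReal.toReal_zero] at this
    exact this
  -- the rescaled density on `K` against the tail
  have hkey : ∀ j, |(ν * R j ^ (-(1 : ℝ) / 3)) *
      ∫ y, φ y * frobeniusNormSq (fderiv ℝ (blowDown (R j) v) y)| ≤ |ν| * Mφ * (T j).toReal := by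
    intro j
    have hRj := hRpos j
    have hRj0 : (R j) ≠ 0 := hRj.ne'
    set c : ℝ := R j ^ ((1 : ℝ) / 3) with hc
    have hc0 : 0 < c := Real.rpow_pos_of_pos hRj _
    have hR3 : R j = c ^ 3 := by
      rw [hc, ← Real.rpow_natCast, ← Real.rpow_mul hRj.le]; norm_num
    have h23 : R j ^ ((2 : ℝ) / 3) = c ^ 2 := by
      rw [hc, ← Real.rpow_natCast, ← Real.rpow_mul hRj.le]; norm_num
    have hneg : R j ^ (-(1 : ℝ) / 3) = c⁻¹ := by
      rw [hc, ← Real.rpow_neg_one, ← Real.rpow_mul hRj.le]; norm_num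
    -- the rescaled Frobenius density
    set g : E3 → ℝ := fun y => frobeniusNormSq (fderiv ℝ (blowDown (R j) v) y) with hg
    have hg_eq : ∀ y, g y = (c ^ 5) ^ 2 * frobeniusNormSq (fderiv ℝ v (R j • y)) := fun y => by
      show frobeniusNormSq (fderiv ℝ (blowDown (R j) v) y) = _
      have hfrob : ∀ (k : ℝ) (L : E3 →L[ℝ] E3),
          frobeniusNormSq (k • L) = k ^ 2 * frobeniusNormSq L := fun k L => by
        simp [frobeniusNormSq, norm_smul, mul_pow, Finset.mul_sum, sq_abs]
      rw [fderiv_blowDown v hRj0 y, hfrob, h23, hR3]; ring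
    have hg0 : ∀ y, 0 ≤ g y := fun y => frobeniusNormSq_nonneg _
    have hgc : Continuous g := by
      have hfun : g = fun y => (c ^ 5) ^ 2 * frobeniusNormSq (fderiv ℝ v (R j • y)) := funext hg_eq
      rw [hfun]
      exact continuous_const.mul (hFc.comp (continuous_const_smul (R j)))
    -- |∫ φ g| ≤ Mφ ∫_K g
    have hgi : IntegrableOn g K volume := hgc.continuousOn.integrableOn_compact hK
    have hbound : |∫ y, φ y * g y| ≤ Mφ * ∫ y in K, g y := by
      have hgi' : IntegrableOn (fun y => Mφ * g y) K volume := hgi.const_mul Mφ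
      have hind : Integrable (K.indicator fun y => Mφ * g y) volume :=
        hgi'.integrable_indicator hK.measurableSet
      have hle : ∀ y, ‖φ y * g y‖ ≤ K.indicator (fun y => Mφ * g y) y := fun y => by
        by_cases hy : y ∈ K
        · rw [indicator_of_mem hy, norm_mul, Real.norm_of_nonneg (hg0 y)]
          exact mul_le_mul_of_nonneg_right (hMφ y) (hg0 y)
        · rw [indicator_of_notMem hy, image_eq_zero_of_notMem_tsupport hy, zero_mul, norm_zero]
      have := norm_integral_le_of_norm_le hind (Eventually.of_forall hle)
      rw [Real.norm_eq_abs, integral_indicator hK.measurableSet, integral_const_mul] at this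
      exact this
    -- ∫_K g = (∫⁻_K ofReal g).toReal and the scaling to the tail
    have hlint : ∫⁻ y in K, ENNReal.ofReal (g y) ≤ ENNReal.ofReal ((c ^ 5) ^ 2 * (R j ^ 3)⁻¹) * T j := by
      have hsub : K ⊆ {y : E3 | δ / 2 < ‖y‖} := fun y hy => by
        show δ / 2 < ‖y‖
        linarith [hKδ y hy]
      calc ∫⁻ y in K, ENNReal.ofReal (g y)
          ≤ ∫⁻ y in {y : E3 | δ / 2 < ‖y‖}, ENNReal.ofReal (g y) := lintegral_mono_set hsub
        _ = ∫⁻ y in {y : E3 | δ / 2 < ‖y‖}, ENNReal.ofReal ((c ^ 5) ^ 2) * F (R j • y) := by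
            refine lintegral_congr fun y => ?_
            rw [hg_eq, ENNReal.ofReal_mul (by positivity)]
        _ = ENNReal.ofReal ((c ^ 5) ^ 2) * ∫⁻ y in {y : E3 | δ / 2 < ‖y‖}, F (R j • y) := by
            rw [lintegral_const_mul' _ _ ENNReal.ofReal_ne_top]
        _ = ENNReal.ofReal ((c ^ 5) ^ 2) * (ENNReal.ofReal ((R j ^ 3)⁻¹) *
              ∫⁻ x in {x : E3 | R j * (δ / 2) < ‖x‖}, F x) := by
            rw [setLIntegral_exterior_comp_smul hRj (δ / 2) F]
        _ = ENNReal.ofReal ((c ^ 5) ^ 2 * (R j ^ 3)⁻¹) * T j := by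
            rw [← mul_assoc, ← ENNReal.ofReal_mul (by positivity)]
    have hreal : ∫ y in K, g y ≤ (c ^ 5) ^ 2 * (R j ^ 3)⁻¹ * (T j).toReal := by
      rw [integral_eq_lintegral_of_nonneg_ae (Eventually.of_forall hg0)
        hgc.aestronglyMeasurable.restrict]
      have := ENNReal.toReal_mono (ENNReal.mul_ne_top ENNReal.ofReal_ne_top (hTfin j)) hlint
      rwa [ENNReal.toReal_mul, ENNReal.toReal_ofReal (by positivity)] at this
    -- assemble: ν R^{-1/3} (c^5)^2 R^{-3} = ν
    have hcoef : R j ^ (-(1 : ℝ) / 3) * ((c ^ 5) ^ 2 * (R j ^ 3)⁻¹) = 1 := by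
      rw [hneg, hR3]; field_simp
    calc |(ν * R j ^ (-(1 : ℝ) / 3)) * ∫ y, φ y * g y|
        = |ν| * R j ^ (-(1 : ℝ) / 3) * |∫ y, φ y * g y| := by
          rw [abs_mul, abs_mul, abs_of_pos (Real.rpow_pos_of_pos hRj _)]
      _ ≤ |ν| * R j ^ (-(1 : ℝ) / 3) * (Mφ * ((c ^ 5) ^ 2 * (R j ^ 3)⁻¹ * (T j).toReal)) := by
          refine mul_le_mul_of_nonneg_left (hbound.trans ?_)
            (mul_nonneg (abs_nonneg _) (Real.rpow_nonneg hRj.le _))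
          exact mul_le_mul_of_nonneg_left hreal hMφ0
      _ = |ν| * Mφ * (T j).toReal * (R j ^ (-(1 : ℝ) / 3) * ((c ^ 5) ^ 2 * (R j ^ 3)⁻¹)) := by
          ring
      _ = |ν| * Mφ * (T j).toReal := by rw [hcoef, mul_one]
  -- squeeze
  have hlim : Tendsto (fun j => |ν| * Mφ * (T j).toReal) atTop (𝓝 0) := by
    have := hTreal.const_mul (|ν| * Mφ)
    rwa [mul_zero] at this
  exact squeeze_zero_norm (fun j => by rw [Real.norm_eq_abs]; exact hkey j) hlim

end Summit.NavierStokesRegularity.NavierStokesRegularity.Theorems.Wu2026Salvage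

end

-- WHAT THIS IS NOT: not a claim about NS regularity or blow-up; not a claim about any author beyond the typed locator.
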